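import Literature.AlgebraicGeometry.Resolution.ExceptionalDivisorTrivialOverAffine
import Literature.AlgebraicGeometry.Resolution.ExceptionalDivisorLocallyTrivial
import Literature.AlgebraicGeometry.Motives.BettiCycleClassProofs
import Literature.AlgebraicGeometry.Motives.CyclesDimensionProofs
import Literature.Topology.KrullDimensionDrop
import Literature.AlgebraicGeometry.Resolution.BlowupDimension
import Literature.AlgebraicGeometry.Resolution.BlowupsIntegral
import Mathlib.RingTheory.Ideal.KrullsHeightTheorem
import HarnessLib

/-!
# Hartshorne II Thm. 8.24 (b) / Liu Thm. 8.1.19 (b): the exceptional divisor is a Zariski-locally trivial `ℙʳ`-bundle — discharge of the named fact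

Topic: `Literature/AlgebraicGeometry/Resolution`. PROOF of the named fact
`Hartshorne1977_exceptionalDivisor_locallyTrivial` (`ExceptionalDivisorLocallyTrivial.lean`): for smooth
projective `k`-varieties `V`, `Z` of dimensions `m + r + 1`, `m`, a closed `k`-immersion `i : Z ↪ V` and a
blowing up `β : B → V` along `ker i`, every point `z ∈ Z` has a Zariski neighbourhood `U` over which the
exceptional divisor `E = B ×_V Z → Z` is `U × ℙʳ_k → U`.

Proof (Liu, Thm. 8.1.19: reduce to the affine quasi-regular case). `V` and `V(ker i) ≅ Z` are regular
(smooth over a field), so near `i z` the centre is cut out, on an affine basic open `W' = D(g)`, by a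
quasi-regular sequence `f₁, …, f_c` (`exists_isQuasiRegular_away_of_isRegularRing`,
`RegularCentreLocal.lean`). Over `W'` the exceptional divisor is therefore `U × ℙ^{c-1}`, `U = i⁻¹W'`
(`exists_iso_tensor_projectiveSpace_of_generators`: the charts `D₊(f_j t)` and the ratios `f_l/f_j` give
`E|_U → ℙ^{c-1}_{Γ(U,𝒪)}`, an isomorphism by `(A/I)[T_l : l ≠ j] ≅ A[I/f_j]/(f_j)`, Stacks 0BIQ). Finally
`c = r + 1`: `c ≥ r + 1` by Krull's height theorem at the generic point of `Z` (the prime of `i(Z) ∩ W'`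
is minimal over `(f)` and has height `codim Z = r + 1`), and `c - 1 ≤ r` because `E|_U ≅ U × ℙ^{c-1}` has
dimension `m + c - 1` while `E ⊊ B` has dimension `≤ m + r`.

* `succ_le_card_generators_of_ker_ideal_eq_span` — the Krull inequality `r + 1 ≤ c`;
* `topologicalKrullDim_preimage_le` — `dim E|_U ≤ m + r`;
* `Hartshorne1977_exceptionalDivisor_locallyTrivial_holds` — **the named fact, proved**.

## References

* [Hartshorne1977] R. Hartshorne, Algebraic Geometry (1977), II Thm. 8.24 (b), II Thm. 8.17.
* [Liu2002] Q. Liu, Algebraic Geometry and Arithmetic Curves (2002), Thm. 8.1.19 (a),(b).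
* [StacksProject] The Stacks Project, Tag 0804, Tag 0BIQ.
-/

noncomputable section

open CategoryTheory CategoryTheory.Limits AlgebraicGeometry TopologicalSpace Opposite
open MonoidalCategory CartesianMonoidalCategory Order
open Literature.AlgebraicGeometry.Motives

namespace Literature.AlgebraicGeometry.Resolution

universe u

/-- **Krull at the generic point of the centre**: if, on an affine open `W'` of the smooth `(m+r+1)`-fold
`V` meeting the smooth `m`-fold `Z ↪ V`, the ideal of `Z` is generated by `c` elements, then
`r + 1 ≤ c` (the prime of the generic point of `Z` in `Γ(V, W')` is minimal over that ideal and has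
height `codim Z = r + 1`; Krull's height theorem). [cite: Liu2002, Thm. 8.1.19 (proof)] -/
theorem succ_le_card_generators_of_ker_ideal_eq_span {k : Type u} [Field k] {m r : ℕ}
    {V Z : SchemeOver k} (hV : IsSmoothProjective (m + r + 1) V) (hZ : IsSmoothProjective m Z)
    (i : Z ⟶ V) [IsClosedImmersion i.left] {W' : V.left.Opens} (hW' : IsAffineOpen W')
    {w : V.left} (hw : w ∈ W') (hwZ : w ∈ Set.range i.left) {c : ℕ} (f : Fin c → Γ(V.left, W'))
    (hgen : i.left.ker.ideal ⟨W', hW'⟩ = Ideal.span (Set.range f)) : r + 1 ≤ c := by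
  classical
  haveI := hV.smoothOfRelativeDimension
  haveI := hZ.smoothOfRelativeDimension
  haveI : IsIntegral V.left := IsSmoothProjective.isIntegral_holds hV
  haveI : IsIntegral Z.left := IsSmoothProjective.isIntegral_holds hZ
  haveI : Smooth V.hom := SmoothOfRelativeDimension.smooth (n := m + r + 1) (f := V.hom)
  haveI : LocallyOfFiniteType V.hom := inferInstance
  haveI : IsLocallyNoetherian V.left := LocallyOfFiniteType.isLocallyNoetherian V.hom
  haveI : IsNoetherianRing Γ(V.left, W') := IsLocallyNoetherian.component_noetherian ⟨W', hW'⟩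
  -- the generic point `ζ` of `Z` and `i ζ ∈ W'`
  obtain ⟨z, rfl⟩ := hwZ
  have hw₀ : i.left (genericPoint Z.left) ∈ W' :=
    (((genericPoint_spec Z.left).specializes (Set.mem_univ z)).map i.left.continuous).mem_open W'.2 hw
  let 𝔮 := hW'.primeIdealOf ⟨i.left (genericPoint Z.left), hw₀⟩
  -- points of `W'` versus primes of `Γ(V, W')`
  have hmemD : ∀ (y : V.left) (hy : y ∈ W') (s : Γ(V.left, W')),
      y ∈ V.left.basicOpen s ↔ s ∉ (hW'.primeIdealOf ⟨y, hy⟩).asIdeal := by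
    intro y hy s
    rw [← PrimeSpectrum.mem_basicOpen, ← hW'.fromSpec_preimage_basicOpen s]
    change _ ↔ hW'.fromSpec (hW'.primeIdealOf ⟨y, hy⟩) ∈ V.left.basicOpen s
    rw [hW'.fromSpec_primeIdealOf ⟨y, hy⟩]
  have hsupp : (i.left.ker.support : Set V.left) = Set.range i.left := by
    rw [Scheme.Hom.support_ker, i.left.isClosedEmbedding.isClosed_range.closure_eq]
  have hle_of_mem : ∀ (y : V.left) (hy : y ∈ W'), y ∈ Set.range i.left →
      i.left.ker.ideal ⟨W', hW'⟩ ≤ (hW'.primeIdealOf ⟨y, hy⟩).asIdeal := by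
    intro y hy hyZ s hs
    have hys : y ∈ (i.left.ker.support : Set V.left) := hsupp ▸ hyZ
    have hzl := (Scheme.IdealSheafData.mem_support_iff_of_mem (I := i.left.ker) (U := ⟨W', hW'⟩) hy).mp hys
    rw [Scheme.mem_zeroLocus_iff] at hzl
    by_contra hsp
    exact hzl s hs ((hmemD y hy s).mpr hsp)
  have hmem_of_le : ∀ (y : V.left) (hy : y ∈ W'),
      i.left.ker.ideal ⟨W', hW'⟩ ≤ (hW'.primeIdealOf ⟨y, hy⟩).asIdeal → y ∈ Set.range i.left := by
    intro y hy hle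
    have hzl : y ∈ V.left.zeroLocus (U := W') (i.left.ker.ideal ⟨W', hW'⟩) := by
      rw [Scheme.mem_zeroLocus_iff]
      intro s hs hys
      exact ((hmemD y hy s).mp hys) (hle hs)
    have hy' := (Scheme.IdealSheafData.mem_support_iff_of_mem (I := i.left.ker) (U := ⟨W', hW'⟩) hy).mpr hzl
    have hy'' : y ∈ (i.left.ker.support : Set V.left) := hy'
    rwa [hsupp] at hy''
  -- `𝔮` is a minimal prime over the ideal of the centre
  have h𝔮le : i.left.ker.ideal ⟨W', hW'⟩ ≤ 𝔮.asIdeal := hle_of_mem _ hw₀ ⟨genericPoint Z.left, rfl⟩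
  have hmin : 𝔮.asIdeal ∈ (Ideal.span (Set.range f)).minimalPrimes := by
    rw [← hgen]
    refine ⟨⟨𝔮.isPrime, h𝔮le⟩, fun P ⟨hP, hleP⟩ _ ↦ ?_⟩
    -- the point `y` of `W'` with prime `P` lies on `Z`, hence specialises from `i ζ`
    let y : V.left := hW'.fromSpec ⟨P, hP⟩
    have hy : y ∈ W' := hW'.range_fromSpec.le ⟨_, rfl⟩
    have hPy : hW'.primeIdealOf ⟨y, hy⟩ = ⟨P, hP⟩ :=
      hW'.fromSpec.isOpenEmbedding.injective (hW'.fromSpec_primeIdealOf ⟨y, hy⟩)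
    have hyZ : y ∈ Set.range i.left := hmem_of_le y hy (hPy ▸ hleP)
    obtain ⟨z', hz'⟩ := hyZ
    have hspec : i.left (genericPoint Z.left) ⤳ y :=
      hz' ▸ ((genericPoint_spec Z.left).specializes (Set.mem_univ z')).map i.left.continuous
    have hspec₁ : hW'.fromSpec 𝔮 ⤳ hW'.fromSpec ⟨P, hP⟩ := by
      rw [hW'.fromSpec_primeIdealOf]
      exact hspec
    have hspec' := (hW'.fromSpec.isOpenEmbedding.isInducing.specializes_iff).mp hspec₁
    exact (PrimeSpectrum.le_iff_specializes 𝔮 ⟨P, hP⟩).mpr hspec'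
  -- Krull: `ht 𝔮 ≤ c`
  have hKrull : 𝔮.asIdeal.height ≤ c := by
    have hmin' : 𝔮.asIdeal ∈ (Ideal.span ↑(Finset.univ.image f)).minimalPrimes := by
      rwa [Finset.coe_image, Finset.coe_univ, Set.image_univ]
    refine (Ideal.height_le_card_of_mem_minimalPrimes_span_finset hmin').trans ?_
    exact_mod_cast Finset.card_image_le.trans (by simp)
  -- `ht 𝔮 = codim_V (i ζ) = (m + r + 1) - m`
  have h1 : 𝔮.asIdeal.height = coheight (i.left (genericPoint Z.left)) := by
    rw [idealHeight_eq_coheight Γ(V.left, W') 𝔮, ← coheight_eq_of_isOpenImmersion (f := hW'.fromSpec),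
      hW'.fromSpec_primeIdealOf]
  have h2 := height_add_coheight_eq_of_smoothOfRelativeDimension V.hom (m + r + 1)
    (i.left (genericPoint Z.left))
  have h3 : height (i.left (genericPoint Z.left)) = (m : ℕ∞) := by
    haveI : Nonempty ↥Z.left := inferInstance
    have h := Scheme.height_genericPoint Z.left
    rw [Scheme.height_base_eq_of_isClosedImmersion i.left,
      topologicalKrullDim_eq_of_smoothOfRelativeDimension (f := Z.hom) (n := m)] at *
    have h' : ((height (genericPoint Z.left) : ℕ∞) : WithBot ℕ∞) = ((m : ℕ∞) : WithBot ℕ∞) := by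
      rw [h, WithBot.coe_natCast]
    exact WithBot.coe_inj.mp h'
  rw [h3] at h2
  -- so `coheight = r + 1 ≤ c`
  have hfin : coheight (i.left (genericPoint Z.left)) ≠ ⊤ := by
    intro htop
    rw [htop, add_top] at h2
    exact (ENat.coe_ne_top (m + r + 1)) h2.symm
  obtain ⟨d, hd⟩ := ENat.ne_top_iff_exists.mp hfin
  rw [← hd] at h2 h1
  have hdm : m + d = m + r + 1 := by exact_mod_cast h2
  rw [h1] at hKrull
  have hdc : d ≤ c := by exact_mod_cast hKrull
  omega

/-- **The preimage of an open of the centre in the exceptional divisor has dimension `≤ m + r`**: the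
exceptional divisor `E = B ×_V Z` embeds into the blowing up `B`, smooth projective of dimension
`m + r + 1`, as a proper closed subset (it misses the points over `V ∖ i(Z)`, where `β` is an isomorphism).
[cite: Liu2002, Thm. 8.1.19 (proof)] [cite: Hartshorne1977, II Prop. 7.13 and Thm. 8.24] -/
theorem topologicalKrullDim_preimage_le {k : Type u} [Field k] {m r : ℕ} {V Z B : SchemeOver k}
    (hV : IsSmoothProjective (m + r + 1) V) (hZ : IsSmoothProjective m Z) (i : Z ⟶ V) (β : B ⟶ V)
    [IsClosedImmersion i.left] (hβ : IsBlowup β.left i.left.ker) (O : (pullback β.left i.left).Opens) :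
    topologicalKrullDim (O : Scheme.{u}) < ((m + r + 1 : ℕ) : WithBot ℕ∞) := by
  haveI := hV.smoothOfRelativeDimension
  haveI := hZ.smoothOfRelativeDimension
  haveI : IsIntegral V.left := IsSmoothProjective.isIntegral_holds hV
  haveI : IsIntegral Z.left := IsSmoothProjective.isIntegral_holds hZ
  -- `i(Z) ≠ V` (dimensions), so `ker i ≠ ⊥`
  have hne : Set.range i.left ≠ Set.univ := by
    intro h
    haveI : Surjective i.left := ⟨Set.range_eq_univ.mp h⟩
    haveI : IsIso i.left := isIso_of_isClosedImmersion_of_surjective i.left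
    have hZd := topologicalKrullDim_eq_of_smoothOfRelativeDimension (f := Z.hom) (n := m)
    have hVd := topologicalKrullDim_eq_of_smoothOfRelativeDimension (f := V.hom) (n := m + r + 1)
    have heq := IsHomeomorph.topologicalKrullDim_eq _ i.left.homeomorph.isHomeomorph
    rw [hZd, hVd] at heq
    have h' : ((m : ℕ∞) : WithBot ℕ∞) = (((m + r + 1 : ℕ) : ℕ∞) : WithBot ℕ∞) := by
      rw [WithBot.coe_natCast, WithBot.coe_natCast]; exact heq
    have h'' : m = m + r + 1 := by exact_mod_cast (ENat.coe_inj.mp (WithBot.coe_inj.mp h'))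
    omega
  -- `B` is irreducible of dimension `≤ m + r + 1` (a blowing up of the integral `V` along `ker i ≠ ⊥`)
  haveI : Smooth V.hom := SmoothOfRelativeDimension.smooth (n := m + r + 1) (f := V.hom)
  haveI : LocallyOfFiniteType V.hom := inferInstance
  haveI : IsLocallyNoetherian V.left := LocallyOfFiniteType.isLocallyNoetherian V.hom
  haveI : IrreducibleSpace ↥B.left := hβ.irreducibleSpace (ker_ne_bot_of_range_ne_univ i.left hne)
  have hdimV : topologicalKrullDim ↥V.left = ((m + r + 1 : ℕ) : WithBot ℕ∞) :=
    topologicalKrullDim_eq_of_smoothOfRelativeDimension (f := V.hom) (n := m + r + 1)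
  have hdimB : topologicalKrullDim ↥B.left ≤ ((m + r + 1 : ℕ) : WithBot ℕ∞) :=
    hβ.topologicalKrullDim_le hdimV.le
  -- the image of `E` in `B` is a proper closed subset
  have hcl : IsClosed (Set.range (pullback.fst β.left i.left)) :=
    (pullback.fst β.left i.left).isClosedEmbedding.isClosed_range
  have hsupp : (i.left.ker.support : Set V.left) = Set.range i.left := by
    rw [Scheme.Hom.support_ker, i.left.isClosedEmbedding.isClosed_range.closure_eq]
  have hneE : Set.range (pullback.fst β.left i.left) ≠ Set.univ := by
    obtain ⟨v, hv⟩ := (Set.ne_univ_iff_exists_notMem _).mp hne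
    let W₀ : V.left.Opens := ⟨(i.left.ker.support : Set V.left)ᶜ, i.left.ker.support.isClosed.isOpen_compl⟩
    haveI : IsIso (β.left ∣_ W₀) := hβ.isIso_compl
    have hvW : v ∈ W₀ := by
      change v ∈ (i.left.ker.support : Set V.left)ᶜ
      rw [hsupp]; exact hv
    obtain ⟨b, hb⟩ := (β.left ∣_ W₀).homeomorph.surjective ⟨v, hvW⟩
    have hβb : β.left ((β.left ⁻¹ᵁ W₀).ι b) = v := by
      have h := Scheme.Hom.comp_apply (β.left ⁻¹ᵁ W₀).ι β.left b
      rw [← morphismRestrict_ι, Scheme.Hom.comp_apply] at h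
      rw [← h]
      exact congrArg (fun t : ↥W₀ ↦ (t : V.left)) hb
    intro huniv
    have hb' : ((β.left ⁻¹ᵁ W₀).ι b : B.left) ∈ Set.range (pullback.fst β.left i.left) :=
      huniv ▸ Set.mem_univ _
    rw [Scheme.Pullback.range_fst] at hb'
    exact hv (hβb ▸ hb')
  have hdimRange := Literature.Topology.topologicalKrullDim_lt_of_isClosed_ssubset hcl hneE (m + r + 1)
    (hdimB.trans_lt (by exact_mod_cast Nat.lt_succ_self _))
  -- `dim O ≤ dim E = dim (image of E)`
  calc topologicalKrullDim (O : Scheme.{u})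
      ≤ topologicalKrullDim ↥(pullback β.left i.left) := O.ι.isOpenEmbedding.isInducing.topologicalKrullDim_le
    _ = topologicalKrullDim (Set.range (pullback.fst β.left i.left)) :=
      IsHomeomorph.topologicalKrullDim_eq _
        (pullback.fst β.left i.left).isClosedEmbedding.isEmbedding.toHomeomorph.isHomeomorph
    _ < ((m + r + 1 : ℕ) : WithBot ℕ∞) := hdimRange

/-- **Hartshorne II Thm. 8.24 (b) / Liu Thm. 8.1.19 (b), proved: the exceptional divisor of the blowing up
of a smooth projective variety along a smooth closed subvariety is a Zariski-locally trivial `ℙʳ`-bundle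
over the centre** (the named fact `Hartshorne1977_exceptionalDivisor_locallyTrivial`).
[cite: Hartshorne1977, II Thm. 8.24 (b) and II Thm. 8.17] [cite: Liu2002, Thm. 8.1.19 (a),(b)] -/
theorem Hartshorne1977_exceptionalDivisor_locallyTrivial_holds :
    Hartshorne1977_exceptionalDivisor_locallyTrivial.{u} := by
  intro k _ m r V Z B i β hV hZ hi hβ z
  classical
  haveI := hi
  haveI := hV.smoothOfRelativeDimension
  haveI := hZ.smoothOfRelativeDimension
  haveI : IsIntegral V.left := IsSmoothProjective.isIntegral_holds hV
  haveI : IsIntegral Z.left := IsSmoothProjective.isIntegral_holds hZ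
  haveI : Smooth V.hom := SmoothOfRelativeDimension.smooth (n := m + r + 1) (f := V.hom)
  haveI : LocallyOfFiniteType V.hom := inferInstance
  haveI : IsLocallyNoetherian V.left := LocallyOfFiniteType.isLocallyNoetherian V.hom
  have hVreg : Scheme.IsRegular V.left := fun x ↦
    isRegularLocalRing_stalk_of_smoothOfRelativeDimension V.hom (m + r + 1) x
  have hZreg : Scheme.IsRegular Z.left := fun x ↦
    isRegularLocalRing_stalk_of_smoothOfRelativeDimension Z.hom m x
  have hYreg : Scheme.IsRegular i.left.ker.subscheme := isRegular_ker_subscheme i.left hZreg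
  -- an affine open `W ∋ i z`; `Γ(W)` and `Γ(W)/(ker i)(W)` are regular rings
  obtain ⟨W, hW, hxW, -⟩ := exists_isAffineOpen_mem_and_subset (X := V.left) (x := i.left z) (U := ⊤)
    (Opens.mem_top _)
  haveI : IsNoetherianRing Γ(V.left, W) := IsLocallyNoetherian.component_noetherian ⟨W, hW⟩
  haveI : IsRegularRing Γ(V.left, W) := hVreg.isRegularRing_of_isAffineOpen hW
  haveI : IsRegularRing (Γ(V.left, W) ⧸ i.left.ker.ideal ⟨W, hW⟩) := by
    have hreg : Scheme.IsRegular (Spec (i.left.ker.subschemeCover.X ⟨W, hW⟩)) :=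
      Scheme.IsRegular.of_isOpenImmersion (i.left.ker.subschemeCover.f ⟨W, hW⟩) hYreg
    exact (Scheme.isRegular_Spec_iff (.of (Γ(V.left, W) ⧸ i.left.ker.ideal ⟨W, hW⟩))).mp hreg
  -- the prime `𝔭` of `i z` contains `(ker i)(W)`
  have hmemD : ∀ g : Γ(V.left, W), i.left z ∈ V.left.basicOpen g ↔
      g ∉ (hW.primeIdealOf ⟨i.left z, hxW⟩).asIdeal := by
    intro g
    rw [← PrimeSpectrum.mem_basicOpen, ← hW.fromSpec_preimage_basicOpen g]
    change _ ↔ hW.fromSpec (hW.primeIdealOf ⟨i.left z, hxW⟩) ∈ V.left.basicOpen g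
    rw [hW.fromSpec_primeIdealOf ⟨i.left z, hxW⟩]
  have hsupp : (i.left.ker.support : Set V.left) = Set.range i.left := by
    rw [Scheme.Hom.support_ker, i.left.isClosedEmbedding.isClosed_range.closure_eq]
  have hxs : i.left z ∈ (i.left.ker.support : Set V.left) := by rw [hsupp]; exact ⟨z, rfl⟩
  have hIp : i.left.ker.ideal ⟨W, hW⟩ ≤ (hW.primeIdealOf ⟨i.left z, hxW⟩).asIdeal := by
    intro s hs
    have hz := (Scheme.IdealSheafData.mem_support_iff_of_mem (I := i.left.ker) (U := ⟨W, hW⟩) hxW).mp hxs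
    rw [Scheme.mem_zeroLocus_iff] at hz
    by_contra hsp
    exact hz s hs ((hmemD s).mpr hsp)
  -- the local structure theorem: on `W' = D(g) ∋ i z` the centre is cut out by a quasi-regular sequence
  obtain ⟨g, hgp, c, f, hfI, hloc⟩ := exists_isQuasiRegular_away_of_isRegularRing (i.left.ker.ideal ⟨W, hW⟩) _ hIp
  have hxg : i.left z ∈ V.left.basicOpen g := (hmemD g).mpr hgp
  have hW' : IsAffineOpen (V.left.basicOpen g) := hW.basicOpen g
  -- (1) the generators on `W'`, read in `Γ(V, W')`: Krull gives `r + 1 ≤ c`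
  haveI := hW.isLocalization_basicOpen g
  obtain ⟨hIL₂, -, -, -⟩ := hloc Γ(V.left, V.left.basicOpen g)
  have hgen₂ : i.left.ker.ideal ⟨V.left.basicOpen g, hW'⟩ =
      Ideal.span (Set.range (algebraMap Γ(V.left, W) Γ(V.left, V.left.basicOpen g) ∘ f)) := by
    rw [← hIL₂]
    exact (i.left.ker.map_ideal_basicOpen ⟨W, hW⟩ g).symm
  have hrc : r + 1 ≤ c :=
    succ_le_card_generators_of_ker_ideal_eq_span hV hZ i hW' hxg ⟨z, rfl⟩ _ hgen₂
  obtain ⟨n, rfl⟩ : ∃ n, c = n + 1 := ⟨c - 1, by omega⟩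
  -- (2) the generators on `W'`, read in `Γ(W', 𝒪_{W'})` (a localisation of `Γ(W)` away from `g`)
  set W₁ : V.left.Opens := V.left.basicOpen g with hW₁
  haveI : IsAffine (W₁ : Scheme.{u}) := hW'
  have hle : W₁.ι ''ᵁ ⊤ ≤ W := by rw [Scheme.Opens.ι_image_top]; exact V.left.basicOpen_le g
  letI alg : Algebra Γ(V.left, W) Γ((W₁ : Scheme.{u}), ⊤) :=
    (V.left.presheaf.map (homOfLE hle).op).hom.toAlgebra
  haveI hlocV : IsLocalization.Away g Γ((W₁ : Scheme.{u}), ⊤) := by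
    refine IsLocalization.isLocalization_of_algEquiv (Submonoid.powers g)
      (AlgEquiv.ofRingEquiv (f := W₁.topIso.symm.commRingCatIsoToRingEquiv) fun a => ?_)
    have hcomp : V.left.presheaf.map (homOfLE (V.left.basicOpen_le g)).op ≫ W₁.topIso.inv =
        V.left.presheaf.map (homOfLE hle).op := by
      rw [Scheme.Opens.topIso_inv]
      exact ((V.left.presheaf.map_comp _ _).symm.trans (by rfl))
    exact congrArg (fun φ : Γ(V.left, W) ⟶ Γ((W₁ : Scheme.{u}), ⊤) => φ.hom a) hcomp
  obtain ⟨hIL, hqr, -, -⟩ := hloc Γ((W₁ : Scheme.{u}), ⊤)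
  have hJV : (i.left.ker.comap W₁.ι).ideal ⟨⊤, isAffineOpen_top _⟩ =
      Ideal.span (Set.range (algebraMap Γ(V.left, W) Γ((W₁ : Scheme.{u}), ⊤) ∘ f)) := by
    rw [← hIL, Scheme.IdealSheafData.ideal_comap_of_isOpenImmersion, Scheme.Opens.ι_appIso,
      Iso.refl_inv]
    have hWV : i.left.ker.ideal ⟨W₁.ι ''ᵁ ⊤, (isAffineOpen_top (W₁ : Scheme.{u})).image_of_isOpenImmersion W₁.ι⟩ =
        (i.left.ker.ideal ⟨W, hW⟩).map (V.left.presheaf.map (homOfLE hle).op).hom :=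
      (i.left.ker.map_ideal (U := ⟨W₁.ι ''ᵁ ⊤, _⟩) (V := ⟨W, hW⟩) hle).symm
    rw [hWV]
    change ((i.left.ker.ideal ⟨W, hW⟩).map _).comap (RingHom.id _) = _
    rw [Ideal.comap_id]
    rfl
  -- (3) the exceptional divisor over `U = i⁻¹ W'` is `U × ℙⁿ`
  obtain ⟨ψ, hψ⟩ := exists_iso_tensor_projectiveSpace_of_generators i β hβ W₁ hW'
    (algebraMap Γ(V.left, W) Γ((W₁ : Scheme.{u}), ⊤) ∘ f) hJV.symm hqr
  -- (4) dimension count: `n ≤ r`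
  have hP : IsSmoothProjective n (projectiveSpace n k) := isSmoothProjective_projectiveSpace_holds k n
  haveI := hP.smoothOfRelativeDimension
  haveI := hP.geometricallyIrreducible
  have hnr : n ≤ r := by
    let UO : SchemeOver k := Over.mk ((i.left ⁻¹ᵁ W₁).ι ≫ Z.hom)
    let f₁ : (UO ⊗ projectiveSpace n k).left ⟶ (↑(i.left ⁻¹ᵁ W₁) : Scheme.{u}) :=
      (fst UO (projectiveSpace n k)).left
    haveI hfst : SmoothOfRelativeDimension n f₁ := by
      have := smoothOfRelativeDimension_isStableUnderBaseChange (n := n)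
      change SmoothOfRelativeDimension n (pullback.fst ((i.left ⁻¹ᵁ W₁).ι ≫ Z.hom) (projectiveSpace n k).hom)
      exact MorphismProperty.pullback_fst (P := @SmoothOfRelativeDimension n) _ _ hP.smoothOfRelativeDimension
    have hsm : SmoothOfRelativeDimension (n + (0 + m)) (f₁ ≫ (i.left ⁻¹ᵁ W₁).ι ≫ Z.hom) := inferInstance
    haveI : SmoothOfRelativeDimension (n + (0 + m)) (UO ⊗ projectiveSpace n k).hom := by
      rw [← Over.w (fst UO (projectiveSpace n k))]; exact hsm
    haveI : Nonempty ↥(UO ⊗ projectiveSpace n k).left := by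
      haveI : Surjective (fst UO (projectiveSpace n k)).left := by
        change Surjective (pullback.fst ((i.left ⁻¹ᵁ W₁).ι ≫ Z.hom) (projectiveSpace n k).hom)
        infer_instance
      obtain ⟨e, -⟩ := (fst UO (projectiveSpace n k)).left.surjective ⟨z, hxg⟩
      exact ⟨e⟩
    have hdimT := topologicalKrullDim_eq_of_smoothOfRelativeDimension
      (f := (UO ⊗ projectiveSpace n k).hom) (n := n + (0 + m))
    have hdimE : topologicalKrullDim
        (↑(pullback.snd β.left i.left ⁻¹ᵁ (i.left ⁻¹ᵁ W₁)) : Scheme.{u}) = ((n + (0 + m) : ℕ) : WithBot ℕ∞) :=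
      (IsHomeomorph.topologicalKrullDim_eq _
        (Scheme.homeoOfIso ((Over.forget _).mapIso ψ)).isHomeomorph).trans hdimT
    have hlt := topologicalKrullDim_preimage_le hV hZ i β hβ (pullback.snd β.left i.left ⁻¹ᵁ (i.left ⁻¹ᵁ W₁))
    rw [hdimE] at hlt
    have h' : n + (0 + m) < m + r + 1 := by exact_mod_cast hlt
    omega
  have hn : n = r := by omega
  subst hn
  exact ⟨i.left ⁻¹ᵁ W₁, hxg, ψ, hψ⟩

end Literature.AlgebraicGeometry.Resolution

end
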